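import Summits.ResolutionOfSingularities.ResolutionOfSingularities.Theorems.PurelyInseparableDim4Target
import Summits.ResolutionOfSingularities.ResolutionOfSingularities.Theorems.PurelyInseparableDim4Rules
import Summits.ResolutionOfSingularities.ResolutionOfSingularities.Theorems.PurelyInseparableDim4CoordinateTrap
import Summits.ResolutionOfSingularities.ResolutionOfSingularities.Theorems.MarkedTransferCampaignW46MohWindowShadePSBaseChange
import Literature.AlgebraicGeometry.Resolution.PointBlowupDirectrixBaseChange
import Literature.AlgebraicGeometry.Resolution.CentreBlowupOrdAlongBasics
import HarnessLib
import HarnessLib.Audit.Tags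

/-!
# Purely inseparable fourfolds `z^p + F(x₁,…,x₄)` — the centre game under EXTENSION OF THE FIELD:
# traps go up, terminating rules come down
# [OURS · counted 0 · a statement about OUR frame (`PurelyInseparableDim4Rules`), not about resolution]

Census cell «res-dim4-pi» (D-0157 DOOR 2), width seat `res-dim4-p-14`, brick PR-12b (companion of
`PurelyInseparableDim4GameDeterminacy`).  `TerminatesSomeRule p q` quantifies over EVERY field `K` of
characteristic `p`; the census finds its traps over the prime field.  For an (injective) homomorphism of
fields `f : k →+* K` and the coefficient map `s ↦ s♯ := (F ⊗_f K, r, exc)` on presented states: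

* §1 (model level, any index type `σ`): `ordAlong`, `newMult`, `newExc` are unchanged and
  **`CentreBlowup.step` commutes with `♯`** at a `k`-rational chart point (`step_map`; the point model's
  version is `CampaignW46.MohWindowShadePS.step_map`, whose `deletePthPowers_map` and the tree's
  `CentreBlowup.pointTransform_map_ringHom` are reused); «equimultiple point» is invariant
  (`isEquimultiplePoint_map_ringHom_iff`).
* §2 (frame level): permissibility is invariant (`isPermissibleCentre_map_iff`), edges go up
  (`edge_map`), hence **traps go up** (`isTrap_image`: the image of a trap over `k` is a trap over `K`)
  and **terminating permissible rules come down** (`isPermissibleRule_comap`, `terminatesUnder_comap`: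
  restrict the rule to `k`-states; player B keeps its `k`-rational answers) — the existence of a
  terminating permissible rule is ANTITONE in the field (`exists_rule_anti`).
* §3 (prime field): a nonempty trap over `𝔽_p = ZMod p` defeats every permissible rule over EVERY field
  of characteristic `p` (`not_terminatesUnder_of_isTrap_zmod`); with the tree's one-state trap TRAP-1
  (`Trap1.isTrap_singleton`, res-dim4-idea-3 / K-S2-1): **`not_terminatesUnder_two` — over every field of
  characteristic 2, NO permissible coordinate-centre rule terminates** (the `∀ K` form of
  `not_terminatesSomeRule_two`, which is the `∃ K` form), and no such rule carries a secondary invariant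
  (`not_secondaryInvariantUnder_two`, via `terminatesUnder_of_secondaryInvariantUnder`).

Nothing here proves resolution of singularities in dimension ≥ 4 / characteristic `p`: the trap is the
BLINDNESS of coordinate centres (WORD #20 (b): present already for `(n,e) = (3,1)`), a fact about OUR
frame.  Counted 0; AI work, weaker than expert review.
bears_on: LADDER-RESOLUTION:D157-DOOR2 (res-dim4-pi · PR-12b). Supports stmt-ResolutionOfSingularities-16155
(helper).
-/

set_option linter.dupNamespace false

noncomputable section

namespace Summit.ResolutionOfSingularities.ResolutionOfSingularities.Theorems.PIDim4

namespace BaseChange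

open MvPolynomial
open Literature.AlgebraicGeometry.Resolution
open Literature.AlgebraicGeometry.Resolution.Hauser2010
open Literature.AlgebraicGeometry.Resolution.CentreBlowup
open Summit.ResolutionOfSingularities.ResolutionOfSingularities.Theorems.CampaignW46.MohWindowShadePS
  (deletePthPowers_map)

/-! ## 1. The coordinate-centre step commutes with the coefficient map -/

section Model

variable {σ : Type*} [Fintype σ] [DecidableEq σ] {k K : Type*} [Field k] [Field K] [DecidableEq k]
  [DecidableEq K] (f : k →+* K)

omit [Fintype σ] [DecidableEq σ] [DecidableEq k] [DecidableEq K] in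
/-- `ord_{C_S}(F ⊗ K) = ord_{C_S} F` (the support is unchanged). [folklore] -/
theorem ordAlong_map (S : Finset σ) (F : MvPolynomial σ k) :
    ordAlong S (MvPolynomial.map f F) = ordAlong S F := by
  rw [ordAlong_eq_inf, ordAlong_eq_inf, MvPolynomial.support_map_of_injective F f.injective]

omit [Fintype σ] in
/-- The new multiplicities at a `k`-rational chart point are unchanged by the coefficient map.
[folklore] -/
theorem newMult_map (q : ℕ) (S : Finset σ) (j : σ) (b : σ → k) (s : CState σ k) :
    newMult q S j (f ∘ b) (⟨MvPolynomial.map f s.F, s.r, s.exc⟩ : CState σ K) = newMult q S j b s := by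
  unfold newMult
  have hp : (fun i => (f ∘ b) i = 0) = fun i => b i = 0 := by
    funext i
    rw [Function.comp_apply, map_eq_zero_iff f f.injective]
  simp_rw [hp]
  rw [ordAlong_map]

omit [Fintype σ] in
/-- The new exceptional set at a `k`-rational chart point is unchanged by the coefficient map.
[folklore] -/
theorem newExc_map (j : σ) (b : σ → k) (s : CState σ k) :
    newExc j (f ∘ b) (⟨MvPolynomial.map f s.F, s.r, s.exc⟩ : CState σ K) = newExc j b s := by
  unfold newExc
  have hp : (fun i => (f ∘ b) i = 0) = fun i => b i = 0 := by
    funext i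
    rw [Function.comp_apply, map_eq_zero_iff f f.injective]
  simp_rw [hp]

omit [Fintype σ] in
/-- **The coordinate-centre step (`CentreBlowup.step`: chart transform, translation, cleaning, new
multiplicities and components) commutes with the coefficient map** at a `k`-rational chart point.
[cite: CossartJannsenSaito2020, proof of Thm. 3.10 (p. 50)] [folklore] -/
theorem step_map (q : ℕ) (S : Finset σ) (j : σ) (b : σ → k) (s : CState σ k) :
    step q S j (f ∘ b) (⟨MvPolynomial.map f s.F, s.r, s.exc⟩ : CState σ K) =
      ⟨MvPolynomial.map f (step q S j b s).F, (step q S j b s).r, (step q S j b s).exc⟩ := by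
  unfold step
  rw [pointTransform_map_ringHom, deletePthPowers_map, newMult_map, newExc_map]

omit [Fintype σ] [DecidableEq k] [DecidableEq K] in
/-- «Equimultiple point» (centre version) is invariant under the coefficient map at a rational point —
`CentreBlowup.isEquimultiplePoint_map_iff` for an arbitrary homomorphism of fields.
[cite: CossartJannsenSaito2020, Def. 3.13 (1)] -/
theorem isEquimultiplePoint_map_ringHom_iff (q : ℕ) (S : Finset σ) (j : σ) (b : σ → k) (s : CState σ k) :
    IsEquimultiplePoint q S j (f ∘ b) (⟨MvPolynomial.map f s.F, s.r, s.exc⟩ : CState σ K) ↔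
      IsEquimultiplePoint q S j b s := by
  letI : Algebra k K := f.toAlgebra
  exact isEquimultiplePoint_map_iff (K := k) (K' := K) q S j b s

end Model

/-! ## 2. The frame: permissibility, edges, traps, rules -/

section Frame

variable {k K : Type} [Field k] [Field K] [DecidableEq k] [DecidableEq K] (f : k →+* K)

include f

omit [DecidableEq k] [DecidableEq K] in
/-- Permissibility of a coordinate centre is invariant under the coefficient map. [folklore] -/
theorem isPermissibleCentre_map_iff (q : ℕ) (S : Finset (Fin 4)) (F : MvPolynomial (Fin 4) k) :
    IsPermissibleCentre q S (MvPolynomial.map f F) ↔ IsPermissibleCentre q S F := by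
  unfold IsPermissibleCentre
  rw [ordAlong_map]

/-- **Edges go up**: a blow-up edge over `k` is a blow-up edge over `K` between the mapped states
(player B keeps its `k`-rational answer). [folklore] -/
theorem edge_map {q : ℕ} {S : Finset (Fin 4)} {s s' : State k} (h : Edge q S s s') :
    Edge q S (⟨MvPolynomial.map f s.F, s.r, s.exc⟩ : State K) ⟨MvPolynomial.map f s'.F, s'.r, s'.exc⟩ := by
  obtain ⟨j, b, hj, hbj, heq, hne, rfl⟩ := h
  refine ⟨j, f ∘ b, hj, by rw [Function.comp_apply, hbj, map_zero],
    (isEquimultiplePoint_map_ringHom_iff f q S j b s).mpr heq, ?_, ?_⟩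
  · rw [step_map]
    show MvPolynomial.map f (step q S j b s).F ≠ 0
    exact fun h0 => hne (MvPolynomial.map_injective f f.injective (by rw [h0, map_zero]))
  · rw [step_map]

/-- **Traps go up**: the image of a trap over `k` under the coefficient map is a trap over `K`.
[folklore] -/
theorem isTrap_image {q : ℕ} {T : Set (State k)} (hT : IsTrap q T) :
    IsTrap q ((fun s : State k => (⟨MvPolynomial.map f s.F, s.r, s.exc⟩ : State K)) '' T) := by
  rintro _ ⟨s, hs, rfl⟩
  obtain ⟨hord, hall⟩ := hT s hs
  refine ⟨by rwa [ordAlong_map], fun S hS => ?_⟩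
  obtain ⟨s', hs', hedge⟩ := hall S ((isPermissibleCentre_map_iff f q S s.F).mp hS)
  exact ⟨_, ⟨s', hs', rfl⟩, edge_map f hedge⟩

/-- A nonempty trap over `k` defeats every permissible rule over every extension `K` of `k`.
[folklore] -/
theorem not_terminatesUnder_of_isTrap_map {q : ℕ} {T : Set (State k)} (hT : IsTrap q T)
    (hne : T.Nonempty) (R : CentreRule K) (hR : IsPermissibleRule q R) : ¬ TerminatesUnder q R :=
  not_terminatesUnder_of_trap q _ (isTrap_image f hT) (hne.image _) R hR

omit [DecidableEq k] [DecidableEq K] in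
/-- **Rules come down (permissibility)**: the restriction `s ↦ R (s♯)` of a permissible rule over `K`
to `k`-states is a permissible rule over `k`. [folklore] -/
theorem isPermissibleRule_comap {q : ℕ} {R : CentreRule K} (hR : IsPermissibleRule q R) :
    IsPermissibleRule q (fun s : State k => R ⟨MvPolynomial.map f s.F, s.r, s.exc⟩) := by
  intro s hs
  obtain ⟨S, hS⟩ := hs
  exact (isPermissibleCentre_map_iff f q _ s.F).mp
    (hR ⟨MvPolynomial.map f s.F, s.r, s.exc⟩ ⟨S, (isPermissibleCentre_map_iff f q S s.F).mpr hS⟩)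

/-- **Rules come down (termination)**: if `R` has no infinite branch over `K`, its restriction to
`k`-states has none over `k` (a `k`-branch maps to a `K`-branch). [folklore] -/
theorem terminatesUnder_comap {q : ℕ} {R : CentreRule K} (hT : TerminatesUnder q R) :
    TerminatesUnder q (fun s : State k => R ⟨MvPolynomial.map f s.F, s.r, s.exc⟩) := by
  rintro ⟨c, hc⟩
  refine hT ⟨fun n => ⟨MvPolynomial.map f (c n).F, (c n).r, (c n).exc⟩, fun n => ?_⟩
  exact ⟨(isPermissibleCentre_map_iff f q _ (c n).F).mpr (hc n).1, edge_map f (hc n).2⟩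

/-- **The existence of a terminating permissible rule is antitone in the field.** [folklore] -/
theorem exists_rule_anti {q : ℕ}
    (h : ∃ R : CentreRule K, IsPermissibleRule q R ∧ TerminatesUnder q R) :
    ∃ R : CentreRule k, IsPermissibleRule q R ∧ TerminatesUnder q R := by
  obtain ⟨R, hR, hT⟩ := h
  exact ⟨_, isPermissibleRule_comap f hR, terminatesUnder_comap f hT⟩

end Frame

/-- A well-founded quantity decreasing along the steps of `R` forbids infinite branches. [folklore] -/
theorem terminatesUnder_of_secondaryInvariantUnder {K : Type} [Field K] [DecidableEq K] {q : ℕ}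
    {R : CentreRule K} (h : SecondaryInvariantUnder q R) : TerminatesUnder q R := by
  obtain ⟨W, lt, hwf, Φ, hΦ⟩ := h
  rintro ⟨c, hc⟩
  obtain ⟨_, ⟨n, rfl⟩, hmin⟩ := hwf.has_min (Set.range fun n => Φ (c n)) ⟨_, 0, rfl⟩
  exact hmin _ ⟨n + 1, rfl⟩ (hΦ _ _ (hc n))

/-! ## 3. Prime field: one trap over `𝔽_p` settles every field of characteristic `p` -/

/-- **A nonempty trap over `𝔽_p` defeats every permissible coordinate-centre rule over EVERY field of
characteristic `p`.** [folklore] -/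
theorem not_terminatesUnder_of_isTrap_zmod (p q : ℕ) [Fact p.Prime] {T : Set (State (ZMod p))}
    (hT : IsTrap q T) (hne : T.Nonempty) (K : Type) [Field K] [CharP K p] [DecidableEq K]
    (R : CentreRule K) (hR : IsPermissibleRule q R) : ¬ TerminatesUnder q R :=
  not_terminatesUnder_of_isTrap_map (ZMod.castHom (dvd_refl p) K) hT hne R hR

/-- Equivalently: a nonempty trap over `𝔽_p` leaves no field of characteristic `p` with a terminating
permissible rule (the `∀ K` strengthening of `not_terminatesSomeRule_of_trap`). [folklore] -/
theorem forall_not_exists_rule_of_isTrap_zmod (p q : ℕ) [Fact p.Prime] {T : Set (State (ZMod p))}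
    (hT : IsTrap q T) (hne : T.Nonempty) (K : Type) [Field K] [CharP K p] [DecidableEq K] :
    ¬ ∃ R : CentreRule K, IsPermissibleRule q R ∧ TerminatesUnder q R := fun ⟨R, hR, hterm⟩ =>
  not_terminatesUnder_of_isTrap_zmod p q hT hne K R hR hterm

/-- **Over EVERY field of characteristic 2, no permissible coordinate-centre rule terminates at
`q = 2`** — TRAP-1 (`Trap1.isTrap_singleton`, res-dim4-idea-3; K-S2-1 of the census) transported from
`𝔽₂`.  The `∀ K` form of `not_terminatesSomeRule_two`.  A statement about the coordinate-centre frame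
(blindness of coordinate centres to a regular non-coordinate equimultiple curve); nothing about
resolution. [folklore] -/
theorem not_terminatesUnder_two (K : Type) [Field K] [CharP K 2] [DecidableEq K] (R : CentreRule K)
    (hR : IsPermissibleRule 2 R) : ¬ TerminatesUnder 2 R :=
  not_terminatesUnder_of_isTrap_zmod 2 2 Trap1.isTrap_singleton ⟨Trap1.s0, rfl⟩ K R hR

/-- … hence no permissible rule over any field of characteristic 2 carries a secondary invariant at
`q = 2`. [folklore] -/
theorem not_secondaryInvariantUnder_two (K : Type) [Field K] [CharP K 2] [DecidableEq K]
    (R : CentreRule K) (hR : IsPermissibleRule 2 R) : ¬ SecondaryInvariantUnder 2 R := fun h =>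
  not_terminatesUnder_two K R hR (terminatesUnder_of_secondaryInvariantUnder h)

end BaseChange

end Summit.ResolutionOfSingularities.ResolutionOfSingularities.Theorems.PIDim4

end
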